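import Literature.MathematicalPhysics.QuantumFieldTheory.Balaban1983to89.B14Eq364Beta

/-!
# `Balaban1983to89.B14Eq363SummedKernel` — T. Bałaban, *Convergent renormalization expansions for lattice gauge theories*,
# Commun. Math. Phys. **119** (1988) 243–285 [Balaban1988Convergent]: (3.63) p. 282, *"Σ_z Π^{(j)}_{μν}(x, y, z) =
# Π^{(j)}_{μν}(x − y)"* — the `z`-summed three-point kernel IS a translation invariant two-point kernel, PROVED from the
# translation invariance of `Π^{(j)}_{μν}(x, y, z)`; its exponential decay PROVED from (3.48)

statement-level skeleton of published theorems with citation tags; proofs where landed; nothing here is a claim about the Yang–Mills mass gap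

PDF held: `paper:balaban1988-cmp119-convergent-renormalization` (journal page = PDF page + 242); pp. 281–283 [PDF 39–41] read
from the OCR text layer (`lit read … --pages 39-41`) and the x2 renders of the cell `pub-balaban`.

CITATION HEADER (lean-in-tree rule).  WHAT IS REPRODUCED, verbatim, p. 282 [PDF 40]: *"From the equality (2.26) for
Λ_j = L^{−j}Z^d, and from the definitions (I.1.20), (I.5.1), we obtain  Σ_z Π^{(j)}_{μν}(x, y, z) = Π^{(j)}_{μν}(x − y). (3.63)"*,
where (p. 281) `Π^{(j)}_{μν}(x, y, z)` is *"given by the formula (3.50), but with 𝐄^{(j)}(X, U_j, z) replaced by 𝐄^{(j)}(U_j, z)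
defined on the whole lattice"* and *"This function is translation invariant"*.  SKELETON row **B14.Eq3.62–3.64** (owner r11):
(3.63) was typed by `B14Eq364Beta` (p245863) as the `Prop` `B14.Eq364Beta.Eq363 P3 P` relating the abstract three-point kernel
`P3` to an abstract kernel `P : B12Beta.Kernel d` of [I], and enters the (3.64) chain `B14.Eq364Beta.eq364` as the HYPOTHESIS
`h363`; ROWS-B14 ≤ v1.19: *"(3.63) identification with [I] (1.20)/(5.1): typed as Prop, not proved"*.

WHAT THIS FILE PROVES (the two halves of (3.63) that are statements about `Π^{(j)}_{μν}(x, y, z)` itself).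
(1) `eq363_of_translInv` — for a translation invariant three-point kernel (`TranslInv P3`, p. 281) the `z`-sum
`Σ_z Π_{μν}(x, y, z)` depends on `x, y` through `x − y` only and equals `Π_{μν}(x − y)` for the **summed kernel**
`sumKernel P3 μ ν v := Σ_z Π_{μν}(v, 0, z)`: `Eq363 P3 (sumKernel P3)` — NO summability needed (re-indexing `z ↦ z − y` is a
bijection of `Z^d`, `Equiv.tsum_eq`).  (2) `eq363_iff` — conversely any kernel `P` with `Eq363 P3 P` IS the summed kernel; so the
`P` of `B14.Eq364Beta.eq364` is determined, and (3) `eq364_summed` restates that theorem with `h363` DISCHARGED.  (4)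
`abs_sumKernel_le` / `expBound_sumKernel` — under the product decay `Decay3 P3 C κ` ((3.48) p. 280) the summed kernel decays
like `C·S·e^{−(κ/2)|v|₁}`, `S = Σ_z e^{−(κ/2)|z|₁}` (half of the rate pays for `|v|₁ ≤ |v − z|₁ + |z|₁`): this is the decay
hypothesis `ExpBound` of `B14.Eq364Beta.eq364_fourier` ((3.64) middle member) and of [I] (I.5.10), now PROVED for the summed
kernel.  WHAT STAYS BY REFERENCE: that [I]'s own kernel (I.1.20)/(I.5.1) is this summed kernel is a matter of [I]'s DEFINITION of
`Π_{μν}` from the whole-lattice action `𝐄^{(j)}(U_j) = Σ_z 𝐄^{(j)}(U_j, z)` ((2.26) on `L^{−j}Z^d`; the finite-volume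
differentiation step is `B14.Eq364Beta.iteratedFDeriv_two_of_eq226`); [I] is not in the tree beyond its typed rows.

Mega-formalization `lit-balaban`, unit `lit-balaban-r11` gen 4 (B14 fold owner), HOME `run/shared/lean/pub/lit-balaban/`.

## References
* [Balaban1988Convergent] T. Bałaban, Commun. Math. Phys. 119 (1988) 243–285, (3.48) p.280, p.281, (3.63) p.282, (3.64) p.283.
* [Balaban1987RG1] T. Bałaban, Commun. Math. Phys. 109 (1987) 249–301 ([I]: (1.20), (5.1), (5.10)).
-/

namespace Literature.MathematicalPhysics.QuantumFieldTheory.Balaban1983to89.B14.Eq363SummedKernel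

open _root_.Filter _root_.Topology Finset
open Literature.MathematicalPhysics.QuantumFieldTheory.GawedzkiKupiainen1985.PeriodicGleason
open Literature.MathematicalPhysics.QuantumFieldTheory.Balaban1983to89
open Literature.MathematicalPhysics.QuantumFieldTheory.Balaban1983to89.B14.Eq364Beta

variable {d : ℕ}

/-! ## §1. The summed kernel and (3.63) from translation invariance -/

/-- The `z`-summed three-point kernel at `y = 0`: `Π_{μν}(v) := Σ_z Π_{μν}(v, 0, z)` — the right side of (3.63) as a
two-point kernel of [I]'s type `B12Beta.Kernel d`. [cite: Balaban1988Convergent, (3.63) p.282] -/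
noncomputable def sumKernel (P3 : Fin d → Fin d → Pt d → Pt d → Pt d → ℝ) : B12Beta.Kernel d :=
  fun μ ν v => ∑' z : Pt d, P3 μ ν v 0 z

variable {P3 : Fin d → Fin d → Pt d → Pt d → Pt d → ℝ} {C κ : ℝ}

/-- unfolding. [cite: Balaban1988Convergent, (3.63) p.282] -/
theorem sumKernel_apply (P3 : Fin d → Fin d → Pt d → Pt d → Pt d → ℝ) (μ ν : Fin d) (v : Pt d) :
    sumKernel P3 μ ν v = ∑' z : Pt d, P3 μ ν v 0 z := rfl

/-- *"Using the translation invariance"* (p. 282): `Π(x, y, z) = Π(x − y, 0, z − y)`. [cite: Balaban1988Convergent, (3.62) p.282] -/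
theorem translInv_shift (hT : TranslInv P3) (μ ν : Fin d) (x y z : Pt d) :
    P3 μ ν x y z = P3 μ ν (x - y) 0 (z - y) := by
  have h := hT μ ν (x - y) 0 (z - y) y
  rw [sub_add_cancel, zero_add, sub_add_cancel] at h
  exact h

/-- The `z`-sum of a translation invariant kernel depends on `x − y` only: `Σ_z Π(x, y, z) = Σ_z Π(x − y, 0, z)`
(re-indexing `z ↦ z − y`, a bijection of `Z^d`; no summability needed). [cite: Balaban1988Convergent, (3.63) p.282] -/
theorem tsum_translInv (hT : TranslInv P3) (μ ν : Fin d) (x y : Pt d) :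
    ∑' z : Pt d, P3 μ ν x y z = ∑' z : Pt d, P3 μ ν (x - y) 0 z := by
  have h1 : (fun z : Pt d => P3 μ ν x y z) = fun z => P3 μ ν (x - y) 0 (Equiv.subRight y z) := by
    funext z
    rw [translInv_shift hT, Equiv.subRight_apply]
  rw [h1]
  exact (Equiv.subRight y).tsum_eq (fun w => P3 μ ν (x - y) 0 w)

/-- **(3.63)** PROVED for the summed kernel: `Σ_z Π^{(j)}_{μν}(x, y, z) = Π^{(j)}_{μν}(x − y)` with `Π^{(j)}_{μν} = sumKernel P3`,
for every translation invariant three-point kernel. [cite: Balaban1988Convergent, (3.63) p.282] -/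
theorem eq363_of_translInv (hT : TranslInv P3) : Eq363 P3 (sumKernel P3) := by
  intro μ ν x y
  rw [tsum_translInv hT, sumKernel_apply]

/-- Any kernel satisfying (3.63) IS the summed kernel (take `y = 0`). [cite: Balaban1988Convergent, (3.63) p.282] -/
theorem eq_sumKernel_of_eq363 {P : B12Beta.Kernel d} (h : Eq363 P3 P) (μ ν : Fin d) (v : Pt d) :
    P μ ν v = sumKernel P3 μ ν v := by
  have h0 := h μ ν v 0
  rw [sub_zero] at h0
  rw [← h0, sumKernel_apply]

/-- (3.63) CHARACTERISES the two-point kernel: for translation invariant `Π(x, y, z)`, `Eq363 P3 P` holds iff `P` is the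
summed kernel. [cite: Balaban1988Convergent, (3.63) p.282] -/
theorem eq363_iff (hT : TranslInv P3) (P : B12Beta.Kernel d) :
    Eq363 P3 P ↔ P = sumKernel P3 := by
  constructor
  · intro h
    funext μ ν v
    exact eq_sumKernel_of_eq363 h μ ν v
  · rintro rfl
    exact eq363_of_translInv hT

/-! ## §2. Exponential decay of the summed kernel from (3.48) -/

/-- `|v|₁ ≤ |v − z|₁ + |z|₁` on `Z^d`. [folklore] -/
private theorem l1_le_sub_add (v z : Pt d) : l1 v ≤ l1 (v - z) + l1 z := by
  unfold l1
  rw [← Finset.sum_add_distrib]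
  refine Finset.sum_le_sum fun j _ => ?_
  have : ((v j : ℤ) : ℝ) = ((v - z) j : ℤ) + (z j : ℤ) := by push_cast [Pi.sub_apply]; ring
  rw [this]
  exact abs_add_le _ _

/-- `|−z|₁ = |z|₁`. [folklore] -/
private theorem l1_neg' (z : Pt d) : l1 (-z) = l1 z := by
  simp [l1]

/-- Half of the rate pays for the distance: `e^{−κ|v−z|₁} e^{−κ|z|₁} ≤ e^{−(κ/2)|v|₁} e^{−(κ/2)|z|₁}` (`0 ≤ κ`). [folklore] -/
private theorem wt_mul_wt_le {κ : ℝ} (hκ : 0 ≤ κ) (v z : Pt d) :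
    wt κ (v - z) * wt κ (-z) ≤ wt (κ / 2) v * wt (κ / 2) z := by
  rw [wt, wt, wt, wt, ← Real.exp_add, ← Real.exp_add, Real.exp_le_exp, l1_neg']
  have h1 := l1_le_sub_add v z
  have h2 := l1_nonneg (v - z)
  have h3 := l1_nonneg z
  nlinarith

/-- The constant `S = Σ_z e^{−(κ/2)|z|₁}` is a convergent series (`0 < κ`). [folklore] -/
private theorem summable_wt_half (hκ : 0 < κ) : Summable fun z : Pt d => wt (κ / 2) z := by
  have h := summable_wt_pw (d := d) (half_pos hκ) 0
  refine h.congr fun z => ?_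
  simp [pw]

/-- Termwise domination of the summand of the summed kernel. [cite: Balaban1988Convergent, (3.48) p.280] -/
private theorem abs_term_le (hD : Decay3 P3 C κ) (hκ : 0 < κ) (μ ν : Fin d) (v z : Pt d) :
    |P3 μ ν v 0 z| ≤ C * wt (κ / 2) v * wt (κ / 2) z := by
  have h := hD μ ν v 0 z
  rw [zero_sub] at h
  have hC := hD.nonneg μ ν
  calc |P3 μ ν v 0 z| ≤ C * wt κ (v - z) * wt κ (-z) := h
    _ = C * (wt κ (v - z) * wt κ (-z)) := by ring
    _ ≤ C * (wt (κ / 2) v * wt (κ / 2) z) := mul_le_mul_of_nonneg_left (wt_mul_wt_le hκ.le v z) hC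
    _ = C * wt (κ / 2) v * wt (κ / 2) z := by ring

/-- **Decay of the summed kernel** from (3.48): `|Π_{μν}(v)| ≤ C · S · e^{−(κ/2)|v|₁}`, `S = Σ_z e^{−(κ/2)|z|₁}`.
[cite: Balaban1988Convergent, (3.48) p.280, (3.63) p.282] -/
theorem abs_sumKernel_le (hD : Decay3 P3 C κ) (hκ : 0 < κ) (μ ν : Fin d) (v : Pt d) :
    |sumKernel P3 μ ν v| ≤ C * (∑' z : Pt d, wt (κ / 2) z) * wt (κ / 2) v := by
  rw [sumKernel_apply]
  have hs : Summable fun z : Pt d => C * wt (κ / 2) v * wt (κ / 2) z := (summable_wt_half hκ).mul_left _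
  have h1 : ‖∑' z : Pt d, P3 μ ν v 0 z‖ ≤ ∑' z : Pt d, C * wt (κ / 2) v * wt (κ / 2) z :=
    tsum_of_norm_bounded hs.hasSum fun z => by
      rw [Real.norm_eq_abs]
      exact abs_term_le hD hκ μ ν v z
  rw [Real.norm_eq_abs, tsum_mul_left] at h1
  calc |∑' z : Pt d, P3 μ ν v 0 z| ≤ C * wt (κ / 2) v * ∑' z : Pt d, wt (κ / 2) z := h1
    _ = C * (∑' z : Pt d, wt (κ / 2) z) * wt (κ / 2) v := by ring

/-- The same as the decay hypothesis `ExpBound` of [I] (I.5.10) / of `B14.Eq364Beta.eq364_fourier`, with rate `κ/2` and constant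
`C·S`, for the complexified summed kernel. [cite: Balaban1988Convergent, (3.48) p.280, (3.64) p.283] -/
theorem expBound_sumKernel (hD : Decay3 P3 C κ) (hκ : 0 < κ) (μ ν : Fin d) :
    ExpBound (κ / 2) (C * ∑' z : Pt d, wt (κ / 2) z) (B12Rep537.ofReal (sumKernel P3 μ ν)) := by
  intro v
  rw [B12Rep537.ofReal, Complex.norm_real, Real.norm_eq_abs]
  exact abs_sumKernel_le hD hκ μ ν v

/-- The summed kernel is absolutely summable over `Z^d` (so [I]'s moments `Σ_v Π_{μν}(v)v_κv_λ` of (I.1.22) make sense for it).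
[cite: Balaban1988Convergent, (3.48) p.280, (3.64) p.283] -/
theorem summable_sumKernel (hD : Decay3 P3 C κ) (hκ : 0 < κ) (μ ν : Fin d) :
    Summable fun v : Pt d => sumKernel P3 μ ν v := by
  have h := (expBound_sumKernel hD hκ μ ν).summable (half_pos hκ)
  have h2 : Summable fun v : Pt d => ((B12Rep537.ofReal (sumKernel P3 μ ν) v).re) := Complex.reCLM.summable h
  refine h2.congr fun v => ?_
  simp [B12Rep537.ofReal]

/-! ## §3. (3.64) with (3.63) discharged -/

/-- **(3.62)–(3.64) for the summed kernel** — `B14.Eq364Beta.eq364` with its hypothesis `h363 : Eq363 P3 P` DISCHARGED by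
`eq363_of_translInv`: for a translation invariant, decaying three-point kernel with vanishing marginals at `z = 0` whose summed
kernel `Π_{μν}(v) = Σ_z Π_{μν}(v, 0, z)` has [I]'s second-order Taylor data with coefficient `β` ((I.5.16)/(I.5.37)),
`β′_j = Π^{(j)}_{22,11} = β`. [cite: Balaban1988Convergent, (3.61)–(3.64) pp.282–283] -/
theorem eq364_summed (hT : TranslInv P3) (hD : Decay3 P3 C κ) (hκ : 0 < κ) {one two : Fin d} (h12 : two ≠ one)
    (hWx : ∀ y, ∑' x, P3 two two x y 0 = 0) (hWy : ∀ x, ∑' y, P3 two two x y 0 = 0) {β : ℝ}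
    (hTD : ∀ μ ν, B12Rep537.TaylorData3 (β : ℂ) μ ν (B12Form543.ofRealK (sumKernel P3) μ ν)) :
    betaPrime P3 one two = β :=
  eq364 hT hD hκ h12 hWx hWy (eq363_of_translInv hT) hTD

/-- **(3.64), first equality, for the summed kernel**: `β′_j = −½ Σ_v Π_{22}(v) v₁²` with `Π = sumKernel P3` — (3.62) and
(3.63) combined, unconditionally in the kernel `P` (no [I] Taylor data needed for this member).
[cite: Balaban1988Convergent, (3.62)–(3.64) pp.282–283] -/
theorem betaPrime_eq_moment_sumKernel (hT : TranslInv P3) (hD : Decay3 P3 C κ) (hκ : 0 < κ) (one two : Fin d)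
    (hWx : ∀ y, ∑' x, P3 two two x y 0 = 0) (hWy : ∀ x, ∑' y, P3 two two x y 0 = 0) :
    betaPrime P3 one two = -(1/2 : ℝ) * ∑' v : Pt d, sumKernel P3 two two v * (v one : ℝ) ^ 2 := by
  rw [eq362a hD hκ one two hWx hWy, eq362b hT, eq362c, eq363_sum hD hκ (eq363_of_translInv hT)]

end Literature.MathematicalPhysics.QuantumFieldTheory.Balaban1983to89.B14.Eq363SummedKernel
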